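import Summits.AtomisticToContinuum.Crystallization.Theorems.ReggeStarCoercivityDefectFreeCrystallizesRouteBetaLawFree
import Summits.AtomisticToContinuum.Crystallization.Theorems.ReggeStarCoercivityDefectFreeCrystallizesFunnelSitesCovariance
import Summits.AtomisticToContinuum.Crystallization.Theorems.ReggeStarCoercivityDefectFreeCrystallizesRelaxedRatio
import Summits.AtomisticToContinuum.Crystallization.Theorems.ReggeStarCoercivityDefectFreeCrystallizesRootCubicCount
import Summits.AtomisticToContinuum.Crystallization.Theorems.ReggeStarCoercivityDefectFreeCrystallizesSiteColumnLJ
import Summits.AtomisticToContinuum.Crystallization.Theorems.ReggeStarCoercivityDefectFreeCrystallizesCubicMarkVersion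

/-!
# Route β of line `palm-good-law`, RESHAPED CORE (crux `ReggeStarCoercivity.DefectFreeCrystallizes`,
# item stmt-AtomisticToContinuum-13603; lead c7, skeleton v24/v25)

The law-free chart-free certificate family of `RouteBetaLawFree` (hypothesis `hcert` of
`RouteBetaLawFree.pricedFloor_of_funnelCertificates`; the registered stub `stub_funnelCertificate` of skeletons v22/v23) is reduced,
sorry-free, to ONE analytic statement — the registered stub `stub_funnelRigidity` of skeleton v24 (hypothesis `hS4` below):
WORD-UNIFORM FUNNEL RIGIDITY AROUND THE IDEAL OWN-WORD REFERENCE WITH PER-FAULT SLACK — by the four stubs landed in the lead's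
wave 2:

* `RelaxedRatio.stub_relaxedRatio` (p141338) — a global minimiser `(a₁, h₁)` of `hcpE` inside item 3063's registry box
  (`39/50·a₁ ≤ h₁ ≤ 17/20·a₁`); any two global minimisers have the same level, so the certificate's `hcpE a₀ h₀` may be read at `(a₁, h₁)`;
* `CubicMarkVersion.stub_cubicMarkVersion` (p142440) — a measurable root-covariant version `C` of the cubic mark agreeing with
  `FunnelSites.IsCubicSite65 (pts μ)` on rooted hard-core configurations;
* `RootCubicCount.stub_rootCubicCount` (p141769) — a charted site of layer `k` has exactly `6·c(k) + 3·c(k+1) + 3·c(k−1)` cubic bonded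
  neighbours (`c(i) = [s i = s (i−1)]`);
* `SiteColumnLJ.stub_siteColumnLJ` (p141765) — the Lennard-Jones site-energy column on the box: `J₃ − J₂ > 0` and
  `hcpE a h + ½(J₃−J₂)(c(k+1) + c(k−1)) ≤ barlowSiteEnergy lennardJones a h s k` (crux 14993's column, item 3063, registry signs).

With `α = (J₃−J₂)/6`, `β = J₃−J₂` and the slack budget `W ≤ J₃−J₂` of `hS4` the certificate's coefficient condition `β + W ≤ 12α` holds,
and at a root of layer `k` the selection part of the level function is `α·#cubic-nbrs − β·[root cubic] = ½(J₃−J₂)(c(k+1)+c(k−1))`, which the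
column converts into the ideal own-word site energy; `hS4` does the rest.  Main results: `funnelCertificates_of_funnelRigidity`,
`defectFreeCrystallizes_of_funnelRigidity` (S4 → crux 9226 → the crux BY NAME) (the v26 ROOT-DISCOUNT reshape S4′ `stub_funnelRigidityRoot` ⇒ S4 is the sibling file `…RouteBetaRootDiscount`): the crux is CLOSED MODULO
{`stub_funnelRigidity`, crux 9226} in the tree, and modulo {`stub_funnelRigidityRoot`, crux 9226} with the sibling.  All `[folklore]` bookkeeping; no definitions.
-/

noncomputable section

open scoped ENNReal
open Filter Topology MeasureTheory

namespace Summit.AtomisticToContinuum.Crystallization.Theorems.PalmGoodLaw.RouteBetaReshape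

open Summit.AtomisticToContinuum.Crystallization.Theses
open Literature.MathematicalPhysics.StatisticalMechanics Literature.Geometry.DiscreteGeometry
open Literature.Probability.Process

/-- Any two global minimisers of the total hcp energy function `hcpE` over the open quadrant have the same level (anchor of this file:
the certificate's level `hcpE a₀ h₀` may be read at the boxed minimiser of `RelaxedRatio.stub_relaxedRatio`). [folklore] -/
theorem hcpE_level_eq_of_isMin :
    ∀ a₀ h₀ a₁ h₁ : ℝ, 0 < a₀ → 0 < h₀ → 0 < a₁ → 0 < h₁ →
      (∀ a h : ℝ, 0 < a → 0 < h →
        Summit.AtomisticToContinuum.Crystallization.Theorems.PalmUnimodularRigidity.LayeredLawsSelectHcp.hcpE a₀ h₀ ≤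
          Summit.AtomisticToContinuum.Crystallization.Theorems.PalmUnimodularRigidity.LayeredLawsSelectHcp.hcpE a h) →
      (∀ a h : ℝ, 0 < a → 0 < h →
        Summit.AtomisticToContinuum.Crystallization.Theorems.PalmUnimodularRigidity.LayeredLawsSelectHcp.hcpE a₁ h₁ ≤
          Summit.AtomisticToContinuum.Crystallization.Theorems.PalmUnimodularRigidity.LayeredLawsSelectHcp.hcpE a h) →
      Summit.AtomisticToContinuum.Crystallization.Theorems.PalmUnimodularRigidity.LayeredLawsSelectHcp.hcpE a₀ h₀ =
        Summit.AtomisticToContinuum.Crystallization.Theorems.PalmUnimodularRigidity.LayeredLawsSelectHcp.hcpE a₁ h₁ :=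
  fun a₀ h₀ a₁ h₁ ha₀ hh₀ ha₁ hh₁ hmin₀ hmin₁ => le_antisymm (hmin₀ a₁ h₁ ha₁ hh₁) (hmin₁ a₀ h₀ ha₀ hh₀)

/-- **Funnel rigidity (S4) ⇒ the law-free certificate family** (main theorem).  Hypothesis `hS4` is VERBATIM the registered stub
`stub_funnelRigidity` of the line's skeleton v24; the conclusion is VERBATIM the hypothesis `hcert` of
`RouteBetaLawFree.pricedFloor_of_funnelCertificates`.  Proof: read the level at the boxed minimiser of `RelaxedRatio.stub_relaxedRatio`;
mark `C` from `CubicMarkVersion.stub_cubicMarkVersion`, weight and transfer from `hS4`, `α = (J₃−J₂)/6`, `β = J₃−J₂`; on a charted rooted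
hard-core configuration the three carrier sets coincide (`count_restrict_singleton_ne_zero_iff`), the root is a lattice site `(k, i, j)`,
the marked-neighbour count is `RootCubicCount.stub_rootCubicCount`, the root mark is `FunnelSites.isCubicSite65_chart_iff`, and the column
`SiteColumnLJ.stub_siteColumnLJ` closes the arithmetic. [folklore] -/
theorem funnelCertificates_of_funnelRigidity :
    (∀ a₁ h₁ : ℝ, 47 / 50 ≤ a₁ → a₁ ≤ 1 → 39 / 50 * a₁ ≤ h₁ → h₁ ≤ 17 / 20 * a₁ →
      (∀ a h : ℝ, 0 < a → 0 < h →
        Summit.AtomisticToContinuum.Crystallization.Theorems.PalmUnimodularRigidity.LayeredLawsSelectHcp.hcpE a₁ h₁ ≤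
          Summit.AtomisticToContinuum.Crystallization.Theorems.PalmUnimodularRigidity.LayeredLawsSelectHcp.hcpE a h) →
      ∃ κ : ℝ, 0 < κ ∧ ∀ δ : ℝ, 0 < δ →
        ∃ (w : EuclideanSpace ℝ (Fin 3) → ℝ≥0∞) (W : ℝ),
          Measurable w ∧ (∀ y, w (-y) = w y) ∧ 0 ≤ W ∧
          (∀ μ : Measure (EuclideanSpace ℝ (Fin 3)), IsRootedHardCore δ μ → ∫⁻ y, w y ∂μ ≤ ENNReal.ofReal W) ∧
          W ≤ barlowCoupling lennardJones a₁ h₁ 3 - barlowCoupling lennardJones a₁ h₁ 2 ∧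
          ∀ ε : ℝ, 0 < ε →
            ∃ R M : ℝ, ∃ t : Measure (EuclideanSpace ℝ (Fin 3)) → EuclideanSpace ℝ (Fin 3) → ℝ,
              (Measurable (Function.uncurry t) ∧ (∀ μ y, |t μ y| ≤ M) ∧ ∀ μ y, R < ‖y‖ → t μ y = 0) ∧
              ∀ (μ : Measure (EuclideanSpace ℝ (Fin 3))) (S : Set (EuclideanSpace ℝ (Fin 3))) (s : ℤ → ℤ)
                (Φ : EuclideanSpace ℝ (Fin 3) → EuclideanSpace ℝ (Fin 3)),
                μ = (Measure.count : Measure (EuclideanSpace ℝ (Fin 3))).restrict S →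
                (0 : EuclideanSpace ℝ (Fin 3)) ∈ S → (∀ x ∈ S, ∀ y ∈ S, x ≠ y → δ ≤ dist x y) →
                (∀ y ∈ S, SetGood S y) → IsHaggSeq s →
                Set.BijOn Φ (barlowStacking 1 (Real.sqrt (2 / 3)) s) S →
                (∀ p ∈ barlowStacking 1 (Real.sqrt (2 / 3)) s, ∀ q ∈ barlowStacking 1 (Real.sqrt (2 / 3)) s,
                  (dist p q = 1 ↔ (0 < dist (Φ p) (Φ q) ∧ dist (Φ p) (Φ q) < 6 / 5))) →
                (∀ p ∈ S, HasSum (fun q : {q : EuclideanSpace ℝ (Fin 3) // q ∈ S ∧ q ≠ p} =>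
                  (deriv lennardJones (dist p q.1) / dist p q.1) • (p - q.1)) 0) →
                ∀ k i j : ℤ, Φ (barlowPos 1 (Real.sqrt (2 / 3)) s k i j) = 0 →
                  (barlowSiteEnergy lennardJones a₁ h₁ s k - ε -
                        (∫⁻ y, {y : EuclideanSpace ℝ (Fin 3) | FunnelSites.IsCubicSite65 S y}.indicator w y ∂μ).toReal ≤
                      (∫ y, lennardJones ‖y‖ ∂μ) / 2 + ∫ y, (t μ y - t (Measure.map (fun z => z - y) μ) (-y)) ∂μ) ∧
                  ((¬ ∃ a : ℝ, 9 / 10 ≤ a ∧ a ≤ 1 ∧ ∃ T : Finset (EuclideanSpace ℝ (Fin 3)),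
                      (↑T : Set (EuclideanSpace ℝ (Fin 3))) =
                        {y : EuclideanSpace ℝ (Fin 3) | μ {y} ≠ 0 ∧ y ≠ 0 ∧ ‖y‖ ≤ 5 / 4 * a} ∧
                      (ShellCloseTo (a / 100) T (Finset.image (fun v : EuclideanSpace ℝ (Fin 3) => a • v) fccKissingPattern) ∨
                        ShellCloseTo (a / 100) T
                          (Finset.image (fun v : EuclideanSpace ℝ (Fin 3) => a • v) hcpKissingPattern))) →
                    barlowSiteEnergy lennardJones a₁ h₁ s k - ε -
                          (∫⁻ y, {y : EuclideanSpace ℝ (Fin 3) | FunnelSites.IsCubicSite65 S y}.indicator w y ∂μ).toReal + κ ≤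
                      (∫ y, lennardJones ‖y‖ ∂μ) / 2 + ∫ y, (t μ y - t (Measure.map (fun z => z - y) μ) (-y)) ∂μ)) →
    ∀ a₀ h₀ : ℝ, 189 / 200 ≤ a₀ → a₀ ≤ 199 / 200 → 77 / 100 ≤ h₀ → h₀ ≤ 163 / 200 →
      (∀ a h : ℝ, 0 < a → 0 < h →
        Summit.AtomisticToContinuum.Crystallization.Theorems.PalmUnimodularRigidity.LayeredLawsSelectHcp.hcpE a₀ h₀ ≤
          Summit.AtomisticToContinuum.Crystallization.Theorems.PalmUnimodularRigidity.LayeredLawsSelectHcp.hcpE a h) →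
      ∃ κ : ℝ, 0 < κ ∧ ∀ δ : ℝ, 0 < δ →
        ∃ (C : Set (Measure (EuclideanSpace ℝ (Fin 3)) × EuclideanSpace ℝ (Fin 3)))
          (w : EuclideanSpace ℝ (Fin 3) → ℝ≥0∞) (α β W : ℝ),
          MeasurableSet C ∧
          (∀ (μ : Measure (EuclideanSpace ℝ (Fin 3))) (y : EuclideanSpace ℝ (Fin 3)),
            (Measure.map (fun z => z - y) μ, -y) ∈ C ↔ (μ, (0 : EuclideanSpace ℝ (Fin 3))) ∈ C) ∧
          Measurable w ∧ (∀ y, w (-y) = w y) ∧ 0 ≤ W ∧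
          (∀ μ : Measure (EuclideanSpace ℝ (Fin 3)), IsRootedHardCore δ μ → ∫⁻ y, w y ∂μ ≤ ENNReal.ofReal W) ∧
          0 ≤ α ∧ 0 ≤ β ∧ β + W ≤ 12 * α ∧
          ∀ ε : ℝ, 0 < ε →
            ∃ R M : ℝ, ∃ t : Measure (EuclideanSpace ℝ (Fin 3)) → EuclideanSpace ℝ (Fin 3) → ℝ,
              (Measurable (Function.uncurry t) ∧ (∀ μ y, |t μ y| ≤ M) ∧ ∀ μ y, R < ‖y‖ → t μ y = 0) ∧
              ∀ μ : Measure (EuclideanSpace ℝ (Fin 3)), IsRootedHardCore δ μ →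
                (∃ S : Set (EuclideanSpace ℝ (Fin 3)),
                  μ = (Measure.count : Measure (EuclideanSpace ℝ (Fin 3))).restrict S ∧
                  (∀ y ∈ S, SetGood S y) ∧
                  ∃ s : ℤ → ℤ, IsHaggSeq s ∧
                    ∃ Φ : EuclideanSpace ℝ (Fin 3) → EuclideanSpace ℝ (Fin 3),
                      Set.BijOn Φ (barlowStacking 1 (Real.sqrt (2 / 3)) s) S ∧
                      ∀ p ∈ barlowStacking 1 (Real.sqrt (2 / 3)) s, ∀ q ∈ barlowStacking 1 (Real.sqrt (2 / 3)) s,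
                        (dist p q = 1 ↔ (0 < dist (Φ p) (Φ q) ∧ dist (Φ p) (Φ q) < 6 / 5))) →
                (∃ S : Set (EuclideanSpace ℝ (Fin 3)),
                  μ = (Measure.count : Measure (EuclideanSpace ℝ (Fin 3))).restrict S ∧
                  ∀ p ∈ S, HasSum (fun q : {q : EuclideanSpace ℝ (Fin 3) // q ∈ S ∧ q ≠ p} =>
                    (deriv lennardJones (dist p q.1) / dist p q.1) • (p - q.1)) 0) →
                (Summit.AtomisticToContinuum.Crystallization.Theorems.PalmUnimodularRigidity.LayeredLawsSelectHcp.hcpE a₀ h₀ - ε +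
                      α * (∫⁻ y, C.indicator (fun p => ({z : EuclideanSpace ℝ (Fin 3) | 0 < ‖z‖ ∧ ‖z‖ < 6 / 5}).indicator
                        (fun _ => (1 : ℝ≥0∞)) p.2) (μ, y) ∂μ).toReal -
                      {μ' : Measure (EuclideanSpace ℝ (Fin 3)) | (μ', (0 : EuclideanSpace ℝ (Fin 3))) ∈ C}.indicator
                        (fun _ => β) μ -
                      (∫⁻ y, C.indicator (fun p => w p.2) (μ, y) ∂μ).toReal ≤
                    (∫ y, lennardJones ‖y‖ ∂μ) / 2 + ∫ y, (t μ y - t (Measure.map (fun z => z - y) μ) (-y)) ∂μ) ∧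
                ((¬ ∃ a : ℝ, 9 / 10 ≤ a ∧ a ≤ 1 ∧ ∃ T : Finset (EuclideanSpace ℝ (Fin 3)),
                    (↑T : Set (EuclideanSpace ℝ (Fin 3))) =
                      {y : EuclideanSpace ℝ (Fin 3) | μ {y} ≠ 0 ∧ y ≠ 0 ∧ ‖y‖ ≤ 5 / 4 * a} ∧
                    (ShellCloseTo (a / 100) T (Finset.image (fun v : EuclideanSpace ℝ (Fin 3) => a • v) fccKissingPattern) ∨
                      ShellCloseTo (a / 100) T
                        (Finset.image (fun v : EuclideanSpace ℝ (Fin 3) => a • v) hcpKissingPattern))) →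
                  Summit.AtomisticToContinuum.Crystallization.Theorems.PalmUnimodularRigidity.LayeredLawsSelectHcp.hcpE a₀ h₀ - ε +
                        α * (∫⁻ y, C.indicator (fun p => ({z : EuclideanSpace ℝ (Fin 3) | 0 < ‖z‖ ∧ ‖z‖ < 6 / 5}).indicator
                          (fun _ => (1 : ℝ≥0∞)) p.2) (μ, y) ∂μ).toReal -
                        {μ' : Measure (EuclideanSpace ℝ (Fin 3)) | (μ', (0 : EuclideanSpace ℝ (Fin 3))) ∈ C}.indicator
                          (fun _ => β) μ -
                        (∫⁻ y, C.indicator (fun p => w p.2) (μ, y) ∂μ).toReal + κ ≤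
                    (∫ y, lennardJones ‖y‖ ∂μ) / 2 + ∫ y, (t μ y - t (Measure.map (fun z => z - y) μ) (-y)) ∂μ)  := by
  classical
  intro hS4 a₀ h₀ ha₀l ha₀u hh₀l hh₀u hmin
  -- S0: a global minimiser INSIDE item 3063's box; any two global minimisers have the same level
  obtain ⟨a₁, h₁, ha₁l, ha₁u, hr₁, hr₂, hmin₁⟩ := RelaxedRatio.stub_relaxedRatio
  have ha₁pos : (0 : ℝ) < a₁ := by linarith
  have hh₁pos : (0 : ℝ) < h₁ := by nlinarith
  have ha₀pos : (0 : ℝ) < a₀ := by linarith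
  have hh₀pos : (0 : ℝ) < h₀ := by linarith
  have hlev : Summit.AtomisticToContinuum.Crystallization.Theorems.PalmUnimodularRigidity.LayeredLawsSelectHcp.hcpE a₀ h₀ =
      Summit.AtomisticToContinuum.Crystallization.Theorems.PalmUnimodularRigidity.LayeredLawsSelectHcp.hcpE a₁ h₁ :=
    hcpE_level_eq_of_isMin a₀ h₀ a₁ h₁ ha₀pos hh₀pos ha₁pos hh₁pos hmin hmin₁
  have hb1 : (47 : ℝ) / 50 ≤ a₁ := by linarith
  have hb2 : a₁ ≤ 1 := by linarith
  -- S3: the letter price `J₃ − J₂ > 0` and the site-energy column at `(a₁, h₁)`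
  obtain ⟨hgap, hcol⟩ := SiteColumnLJ.stub_siteColumnLJ a₁ h₁ hb1 hb2 hr₁ hr₂
  set Jd : ℝ := barlowCoupling lennardJones a₁ h₁ 3 - barlowCoupling lennardJones a₁ h₁ 2 with hJd
  -- S4: funnel rigidity around the ideal own-word reference
  obtain ⟨κ, hκ, hrig⟩ := hS4 a₁ h₁ hb1 hb2 hr₁ hr₂ hmin₁
  refine ⟨κ, hκ, fun δ hδ => ?_⟩
  obtain ⟨w, W, hwm, hweven, hW0, hwW, hWJ, hrigε⟩ := hrig δ hδ
  -- S1: the measurable covariant version of the cubic mark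
  obtain ⟨C, hCm, hCcov, hCiff⟩ := CubicMarkVersion.stub_cubicMarkVersion δ hδ
  refine ⟨C, w, Jd / 6, Jd, W, hCm, hCcov, hwm, hweven, hW0, hwW, div_nonneg hgap.le (by norm_num), hgap.le,
    by linarith, fun ε hε => ?_⟩
  obtain ⟨R, M, t, ht, hpt⟩ := hrigε ε hε
  refine ⟨R, M, t, ht, fun μ hμ hchart hFB => ?_⟩
  obtain ⟨S, hμS, hgood, s, hs, Φ, hbij, hiso⟩ := hchart
  -- the carrier sets of the three descriptions of `μ` coincide
  have hmem : ∀ y : (EuclideanSpace ℝ (Fin 3)), y ∈ S ↔ μ {y} ≠ 0 := fun y => by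
    rw [hμS]; exact (count_restrict_singleton_ne_zero_iff S y).symm
  obtain ⟨S₀, h0, hsep, hμ0⟩ := hμ
  have hmem0 : ∀ y : (EuclideanSpace ℝ (Fin 3)), y ∈ S₀ ↔ μ {y} ≠ 0 := fun y => by
    rw [hμ0]; exact (count_restrict_singleton_ne_zero_iff S₀ y).symm
  have hS₀ : S₀ = S := Set.ext fun y => (hmem0 y).trans (hmem y).symm
  subst hS₀
  obtain ⟨S', hμS', hFB'⟩ := hFB
  have hmem' : ∀ y : (EuclideanSpace ℝ (Fin 3)), y ∈ S' ↔ μ {y} ≠ 0 := fun y => by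
    rw [hμS']; exact (count_restrict_singleton_ne_zero_iff S' y).symm
  have hS' : S' = S₀ := Set.ext fun y => (hmem' y).trans (hmem0 y).symm
  subst hS'
  -- the root is a lattice site of the chart
  obtain ⟨p0, hp0, hΦ0⟩ := hbij.surjOn h0
  obtain ⟨k, i, j, rfl⟩ := hp0
  have key := hpt μ S' s Φ hμS h0 hsep hgood hs hbij hiso hFB' k i j hΦ0
  -- abbreviations for the three letters around the root layer
  set c0 : ℝ := if s k = s (k - 1) then 1 else 0 with hc0
  set cp : ℝ := if s (k + 1) = s k then 1 else 0 with hcp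
  set cm : ℝ := if s (k - 1) = s (k - 2) then 1 else 0 with hcm
  -- `pts μ = S` and the mark on `μ`
  have hpts : Summit.AtomisticToContinuum.Crystallization.Theorems.PalmUnimodularRigidity.LayeredLawsSelectHcp.pts μ = S' :=
    Set.ext fun y => show μ {y} ≠ 0 ↔ y ∈ S' from (hmem y).symm
  have hCμ : ∀ y : (EuclideanSpace ℝ (Fin 3)), (μ, y) ∈ C ↔ FunnelSites.IsCubicSite65 S' y := fun y => by
    rw [hCiff μ ⟨S', h0, hsep, hμS⟩ y, hpts]
  -- (1) the number of marked `6/5`-neighbours = the number of cubic bonded neighbours of the root (S2)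
  set B : Set (EuclideanSpace ℝ (Fin 3)) := {y : (EuclideanSpace ℝ (Fin 3)) | FunnelSites.Bond65 S' 0 y ∧ FunnelSites.IsCubicSite65 S' y} with hB
  obtain ⟨hBfin, hBcard⟩ := RootCubicCount.stub_rootCubicCount s S' Φ hs hbij hiso k i j
  rw [hΦ0] at hBfin hBcard
  have hBm : MeasurableSet B := hBfin.measurableSet
  have hBS : B ⊆ S' := fun y hy => hy.1.2.1
  have hind : ∀ y : (EuclideanSpace ℝ (Fin 3)),
      C.indicator (fun p : Measure (EuclideanSpace ℝ (Fin 3)) × (EuclideanSpace ℝ (Fin 3)) =>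
        ({z : (EuclideanSpace ℝ (Fin 3)) | 0 < ‖z‖ ∧ ‖z‖ < 6 / 5}).indicator (fun _ => (1 : ℝ≥0∞)) p.2) (μ, y) =
        B.indicator (fun _ => (1 : ℝ≥0∞)) y := by
    intro y
    by_cases hyC : (μ, y) ∈ C
    · have hcub : FunnelSites.IsCubicSite65 S' y := (hCμ y).1 hyC
      have hyS : y ∈ S' := hcub.1
      rw [Set.indicator_of_mem hyC]
      by_cases hsh : y ∈ ({z : (EuclideanSpace ℝ (Fin 3)) | 0 < ‖z‖ ∧ ‖z‖ < 6 / 5})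
      · have hyB : y ∈ B := by
          refine ⟨⟨h0, hyS, ?_, ?_⟩, hcub⟩
          · rw [dist_comm, dist_zero_right]; exact hsh.1
          · rw [dist_comm, dist_zero_right]; exact hsh.2
        simp only [Set.indicator_of_mem hsh, Set.indicator_of_mem hyB]
      · have hyB : y ∉ B := by
          intro hyB
          apply hsh
          obtain ⟨⟨-, -, h1, h2⟩, -⟩ := hyB
          rw [dist_comm, dist_zero_right] at h1 h2
          exact ⟨h1, h2⟩
        simp only [Set.indicator_of_notMem hsh, Set.indicator_of_notMem hyB]
    · have hyB : y ∉ B := fun hyB => hyC ((hCμ y).2 hyB.2)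
      rw [Set.indicator_of_notMem hyC, Set.indicator_of_notMem hyB]
  have hnC : (∫⁻ y, C.indicator (fun p : Measure (EuclideanSpace ℝ (Fin 3)) × (EuclideanSpace ℝ (Fin 3)) =>
        ({z : (EuclideanSpace ℝ (Fin 3)) | 0 < ‖z‖ ∧ ‖z‖ < 6 / 5}).indicator (fun _ => (1 : ℝ≥0∞)) p.2) (μ, y) ∂μ).toReal =
        6 * c0 + 3 * cp + 3 * cm := by
    simp_rw [hind]
    rw [lintegral_indicator_const hBm, one_mul, hμS, Measure.restrict_apply hBm, Set.inter_eq_left.2 hBS,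
      Measure.count_apply_finite B hBfin, ENNReal.toReal_natCast, ← Set.ncard_eq_toFinset_card B hBfin, hBcard]
    simp only [hc0, hcp, hcm]
    push_cast [Nat.cast_ite]
    ring
  -- (2) the root is marked iff its layer is cubic
  have hroot : {μ' : Measure (EuclideanSpace ℝ (Fin 3)) | (μ', (0 : (EuclideanSpace ℝ (Fin 3)))) ∈ C}.indicator (fun _ => Jd) μ = Jd * c0 := by
    have hiff : (μ, (0 : (EuclideanSpace ℝ (Fin 3)))) ∈ C ↔ s k = s (k - 1) := by
      rw [hCμ 0, ← hΦ0]
      exact FunnelSites.isCubicSite65_chart_iff hs hbij hiso k i j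
    by_cases h1 : s k = s (k - 1)
    · have hm : μ ∈ {μ' : Measure (EuclideanSpace ℝ (Fin 3)) | (μ', (0 : (EuclideanSpace ℝ (Fin 3)))) ∈ C} := hiff.2 h1
      rw [Set.indicator_of_mem hm, hc0, if_pos h1, mul_one]
    · have hm : μ ∉ {μ' : Measure (EuclideanSpace ℝ (Fin 3)) | (μ', (0 : (EuclideanSpace ℝ (Fin 3)))) ∈ C} := fun hm => h1 (hiff.1 hm)
      rw [Set.indicator_of_notMem hm, hc0, if_neg h1, mul_zero]
  -- (3) the weighted marked sum is the weighted cubic sum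
  have hwC : (∫⁻ y, C.indicator (fun p : Measure (EuclideanSpace ℝ (Fin 3)) × (EuclideanSpace ℝ (Fin 3)) => w p.2) (μ, y) ∂μ) =
      ∫⁻ y, {y : (EuclideanSpace ℝ (Fin 3)) | FunnelSites.IsCubicSite65 S' y}.indicator w y ∂μ := by
    refine lintegral_congr fun y => ?_
    by_cases hyC : (μ, y) ∈ C
    · have hcub : y ∈ {y : (EuclideanSpace ℝ (Fin 3)) | FunnelSites.IsCubicSite65 S' y} := (hCμ y).1 hyC
      rw [Set.indicator_of_mem hyC, Set.indicator_of_mem hcub]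
    · have hcub : y ∉ {y : (EuclideanSpace ℝ (Fin 3)) | FunnelSites.IsCubicSite65 S' y} := fun h => hyC ((hCμ y).2 h)
      rw [Set.indicator_of_notMem hyC, Set.indicator_of_notMem hcub]
  -- the column at the root layer
  have hcolk := hcol s hs k
  have hident : Jd / 6 * (6 * c0 + 3 * cp + 3 * cm) - Jd * c0 = 1 / 2 * Jd * (cp + cm) := by ring
  rw [hnC, hroot, hwC, hlev]
  refine ⟨by linarith [key.1], fun hbad => ?_⟩
  have h2 := key.2 hbad
  linarith

/-- **The crux from funnel rigidity (S4) and crux 9226 (sorry-free)**: `funnelCertificates_of_funnelRigidity`, then the landed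
`RouteBetaLawFree.defectFreeCrystallizes_of_funnelCertificates` (certificates ⇒ priced floor ⇒ R2a″ ⇒ R2a′ ⇒ 9226's hypothesis; P1 good
law, R1 funnel chart, 9227, R3 charging, item 2916 — all landed).  Glue-by candidate for a split of the crux into
{FunnelRigidity, LayeredLawsSelectHcp}. [folklore] -/
theorem defectFreeCrystallizes_of_funnelRigidity
    (hS4 : ∀ a₁ h₁ : ℝ, 47 / 50 ≤ a₁ → a₁ ≤ 1 → 39 / 50 * a₁ ≤ h₁ → h₁ ≤ 17 / 20 * a₁ →
            (∀ a h : ℝ, 0 < a → 0 < h →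
              Summit.AtomisticToContinuum.Crystallization.Theorems.PalmUnimodularRigidity.LayeredLawsSelectHcp.hcpE a₁ h₁ ≤
                Summit.AtomisticToContinuum.Crystallization.Theorems.PalmUnimodularRigidity.LayeredLawsSelectHcp.hcpE a h) →
            ∃ κ : ℝ, 0 < κ ∧ ∀ δ : ℝ, 0 < δ →
              ∃ (w : EuclideanSpace ℝ (Fin 3) → ℝ≥0∞) (W : ℝ),
                Measurable w ∧ (∀ y, w (-y) = w y) ∧ 0 ≤ W ∧
                (∀ μ : Measure (EuclideanSpace ℝ (Fin 3)), IsRootedHardCore δ μ → ∫⁻ y, w y ∂μ ≤ ENNReal.ofReal W) ∧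
                W ≤ barlowCoupling lennardJones a₁ h₁ 3 - barlowCoupling lennardJones a₁ h₁ 2 ∧
                ∀ ε : ℝ, 0 < ε →
                  ∃ R M : ℝ, ∃ t : Measure (EuclideanSpace ℝ (Fin 3)) → EuclideanSpace ℝ (Fin 3) → ℝ,
                    (Measurable (Function.uncurry t) ∧ (∀ μ y, |t μ y| ≤ M) ∧ ∀ μ y, R < ‖y‖ → t μ y = 0) ∧
                    ∀ (μ : Measure (EuclideanSpace ℝ (Fin 3))) (S : Set (EuclideanSpace ℝ (Fin 3))) (s : ℤ → ℤ)
                      (Φ : EuclideanSpace ℝ (Fin 3) → EuclideanSpace ℝ (Fin 3)),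
                      μ = (Measure.count : Measure (EuclideanSpace ℝ (Fin 3))).restrict S →
                      (0 : EuclideanSpace ℝ (Fin 3)) ∈ S → (∀ x ∈ S, ∀ y ∈ S, x ≠ y → δ ≤ dist x y) →
                      (∀ y ∈ S, SetGood S y) → IsHaggSeq s →
                      Set.BijOn Φ (barlowStacking 1 (Real.sqrt (2 / 3)) s) S →
                      (∀ p ∈ barlowStacking 1 (Real.sqrt (2 / 3)) s, ∀ q ∈ barlowStacking 1 (Real.sqrt (2 / 3)) s,
                        (dist p q = 1 ↔ (0 < dist (Φ p) (Φ q) ∧ dist (Φ p) (Φ q) < 6 / 5))) →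
                      (∀ p ∈ S, HasSum (fun q : {q : EuclideanSpace ℝ (Fin 3) // q ∈ S ∧ q ≠ p} =>
                        (deriv lennardJones (dist p q.1) / dist p q.1) • (p - q.1)) 0) →
                      ∀ k i j : ℤ, Φ (barlowPos 1 (Real.sqrt (2 / 3)) s k i j) = 0 →
                        (barlowSiteEnergy lennardJones a₁ h₁ s k - ε -
                              (∫⁻ y, {y : EuclideanSpace ℝ (Fin 3) | FunnelSites.IsCubicSite65 S y}.indicator w y ∂μ).toReal ≤
                            (∫ y, lennardJones ‖y‖ ∂μ) / 2 + ∫ y, (t μ y - t (Measure.map (fun z => z - y) μ) (-y)) ∂μ) ∧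
                        ((¬ ∃ a : ℝ, 9 / 10 ≤ a ∧ a ≤ 1 ∧ ∃ T : Finset (EuclideanSpace ℝ (Fin 3)),
                            (↑T : Set (EuclideanSpace ℝ (Fin 3))) =
                              {y : EuclideanSpace ℝ (Fin 3) | μ {y} ≠ 0 ∧ y ≠ 0 ∧ ‖y‖ ≤ 5 / 4 * a} ∧
                            (ShellCloseTo (a / 100) T (Finset.image (fun v : EuclideanSpace ℝ (Fin 3) => a • v) fccKissingPattern) ∨
                              ShellCloseTo (a / 100) T
                                (Finset.image (fun v : EuclideanSpace ℝ (Fin 3) => a • v) hcpKissingPattern))) →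
                          barlowSiteEnergy lennardJones a₁ h₁ s k - ε -
                                (∫⁻ y, {y : EuclideanSpace ℝ (Fin 3) | FunnelSites.IsCubicSite65 S y}.indicator w y ∂μ).toReal + κ ≤
                            (∫ y, lennardJones ‖y‖ ∂μ) / 2 + ∫ y, (t μ y - t (Measure.map (fun z => z - y) μ) (-y)) ∂μ))
    (h9226 : PalmUnimodularRigidity.LayeredLawsSelectHcp) :
    Summit.AtomisticToContinuum.Crystallization.Theses.ReggeStarCoercivity.DefectFreeCrystallizes :=
  RouteBetaLawFree.defectFreeCrystallizes_of_funnelCertificates (funnelCertificates_of_funnelRigidity hS4) h9226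

end Summit.AtomisticToContinuum.Crystallization.Theorems.PalmGoodLaw.RouteBetaReshape

end
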